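import Mathlib
import HarnessLib
import Summits.ResolutionOfSingularities.ResolutionOfSingularities.Theorems.WildQuotientsWildQuotientResolutionJordanFiveWSide
import Summits.ResolutionOfSingularities.ResolutionOfSingularities.Theorems.WildQuotientsWildQuotientResolutionJordanFiveChartW1Defs
import Summits.ResolutionOfSingularities.ResolutionOfSingularities.Theorems.WildQuotientsWildQuotientResolutionJordanFiveTwistedChart

/-!
# RUNG V5 (`J₅`), W-side at `W₁ = chartW₁ = D₊(H′²t · T′²H′t²)`: `HW₁st` and the seam
(crux stmt-ResolutionOfSingularities-15640 `WildQuotients.WildQuotientResolution`, line `Sketch`;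
chain w45c RUNG V5 `JordanFive.jordanFive_hasResolution_of_bricks` (res-L1-w45c-lead-1 BRICK LIST
v1 `stubs/J5Bricks.lean` l.96–104 `HW₁st`, l.120–131 the `HP₁` binders), res-L1-w45c-plan-1 RULING
10:50Z «stub-5 = (δ1) W-SIDE PACKAGE», W₁ TERM OF RECORD = res-L1-w45c-stub-1's `JordanFive.chartW₁`
(10:57:17Z; `…JordanFiveChartW1Defs.lean`); written by res-D-pv-033 AS res-L1-w45c-stub-5.
[OURS · L1 W4.5c] — assembly of landed decls; NOT a statement of any manuscript.)

* `JordanFive.smul_hPrime`, `JordanFive.smul_tPrime`, `JordanFive.smul_chartW₁_coeff` — every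
  `g ∈ ⟨σ⟩` (J₅ law) fixes `H′`, `T′` and the coefficient `H′²·(T′²H′)` of the `W₁` section
  (stub-1's `JordanFive.map_hPrime` / `map_tPrime`, p522729);
* `JordanFive.preimage_chartW₁_eq` — **`HW₁st` VERBATIM** (J5Bricks l.96–104 at `W₁ := chartW₁`),
  for ANY `ρ` with the affine-quotient law and any stability proof `hJρ`, given the `I₁₂`-stability
  `hI` (lead-1's frame, by name);
* `JordanFive.exists_sectionsEquiv_chartW₁` — **the SEAM at `W₁`** for the `HP₁` binders
  `(ρ hρ ρB haut O₁ hO₁)`: `φ`, `hP`, `Ω : (k[x][I₁₂t])_{(H′²t·T′²H′t²)} ≃+* Γ(↥O₁.1, (O₁.1.ι ≫ π ≫ q)⁻¹ ⊤)`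
  with (o) (i) (ii) (iii) — so `brickHP1` (stub-1) reduces to algebra in the homogeneous localisation.
`HW₁aff` is stub-1's `isAffineOpen_chartW₁` (not restated).
-/

-- single-problem summit: the doubled namespace component `ResolutionOfSingularities` is forced
set_option linter.dupNamespace false

noncomputable section

open CategoryTheory AlgebraicGeometry TopologicalSpace MvPolynomial Polynomial HomogeneousLocalization
open Literature.AlgebraicGeometry.Resolution Literature.AlgebraicGeometry.RelativeSpec
open scoped Pointwise

namespace Summit.ResolutionOfSingularities.ResolutionOfSingularities.Theorems.WildQuotientResolution.JordanFive

variable (k : Type) [Field k] (n : ℕ) (σ : MvPolynomial (Fin n) k ≃ₐ[k] MvPolynomial (Fin n) k)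
  (a b c d e : Fin n) (hab : a ≠ b) (hac : a ≠ c) (had : a ≠ d) (hae : a ≠ e)
  (hb : σ (X b) = X b + X a) (hc : σ (X c) = X c + X b) (hd : σ (X d) = X d + X c)
  (hσ : ∀ i, i ≠ b → i ≠ c → i ≠ d → i ≠ e → σ (X i) = X i)

/-- `k[x] → Γ(Spec k[x], ⊤)` (local shorthand) -/
local notation3 "ι₀" => (Scheme.ΓSpecIso (CommRingCat.of (MvPolynomial (Fin n) k))).inv.hom
/-- the quotient map `q : 𝔸ⁿ → 𝔸ⁿ/⟨σ⟩` (local shorthand) -/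
local notation3 "qσ" => Spec.map (CommRingCat.ofHom (algebraMap
  (FixedPoints.subalgebra k (MvPolynomial (Fin n) k) (Subgroup.zpowers σ)) (MvPolynomial (Fin n) k)))

/-! ## Invariance of `H′`, `T′` under `⟨σ⟩` (J₅ law) -/

include hab hac had hae hb hc hσ in
/-- Every `g ∈ ⟨σ⟩` fixes `H′` (J₅ law). [OURS · L1 W4.5c] [folklore] -/
theorem smul_hPrime (g : ↥(Subgroup.zpowers σ)) :
    g • JordanFour.hPrime k n a b c = JordanFour.hPrime k n a b c := by
  have hσ' : σ • JordanFour.hPrime k n a b c = JordanFour.hPrime k n a b c :=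
    map_hPrime k n a b c (σ : MvPolynomial (Fin n) k →ₐ[k] MvPolynomial (Fin n) k)
      (hσ a hab hac had hae) hb hc
  obtain ⟨z, hz⟩ := Subgroup.mem_zpowers_iff.mp g.2
  change (g : MvPolynomial (Fin n) k ≃ₐ[k] MvPolynomial (Fin n) k) • JordanFour.hPrime k n a b c = _
  rw [← hz]
  exact MulAction.fixedBy_subset_fixedBy_zpow (MvPolynomial (Fin n) k) σ z hσ'

include hab hac had hae hb hc hd hσ in
/-- Every `g ∈ ⟨σ⟩` fixes `T′` (J₅ law). [OURS · L1 W4.5c] [folklore] -/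
theorem smul_tPrime (g : ↥(Subgroup.zpowers σ)) :
    g • JordanFour.tPrime k n a b c d = JordanFour.tPrime k n a b c d := by
  have hσ' : σ • JordanFour.tPrime k n a b c d = JordanFour.tPrime k n a b c d :=
    map_tPrime k n a b c d (σ : MvPolynomial (Fin n) k →ₐ[k] MvPolynomial (Fin n) k)
      (hσ a hab hac had hae) hb hc hd
  obtain ⟨z, hz⟩ := Subgroup.mem_zpowers_iff.mp g.2
  change (g : MvPolynomial (Fin n) k ≃ₐ[k] MvPolynomial (Fin n) k) • JordanFour.tPrime k n a b c d = _
  rw [← hz]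
  exact MulAction.fixedBy_subset_fixedBy_zpow (MvPolynomial (Fin n) k) σ z hσ'

include hab hac had hae hb hc hd hσ in
/-- Every `g ∈ ⟨σ⟩` fixes the coefficient `H′² · (T′² H′)` of the `W₁` section. [OURS · L1 W4.5c]
[folklore] -/
theorem smul_chartW₁_coeff (g : ↥(Subgroup.zpowers σ)) :
    g • (JordanFour.hPrime k n a b c ^ 2 * (JordanFour.tPrime k n a b c d ^ 2 *
      JordanFour.hPrime k n a b c)) =
      JordanFour.hPrime k n a b c ^ 2 * (JordanFour.tPrime k n a b c d ^ 2 *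
        JordanFour.hPrime k n a b c) := by
  rw [smul_mul', smul_mul', smul_pow', smul_pow', smul_hPrime k n σ a b c d e hab hac had hae hb hc hσ,
    smul_tPrime k n σ a b c d e hab hac had hae hb hc hd hσ]

/-! ## `HW₁st` -/

include hab hac had hae hb hc hd hσ in
/-- **Brick `HW₁st` of the J₅ toric exit** (`stubs/J5Bricks.lean` l.96–104 VERBATIM at
`W₁ := chartW₁ k n a b c d`): the twisted μ₃ chart `chartW₁ = D₊(H′²t · T′²H′t²)` is stable under
the lifted action of every `g ∈ ⟨σ⟩`, for ANY `ρ` with the affine-quotient law and any stability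
proof `hJρ`, granted the `⟨σ⟩`-stability `hI` of `I₁₂`. [OURS · L1 W4.5c] [folklore; assembly of
landed decls] -/
theorem preimage_chartW₁_eq
    (hI : ∀ g : ↥(Subgroup.zpowers σ), g • I12 k n a b c d = I12 k n a b c d)
    (ρ : ↥(Subgroup.zpowers σ) →* Aut (Spec (CommRingCat.of (MvPolynomial (Fin n) k))))
    (hρ : ∀ g : ↥(Subgroup.zpowers σ), (ρ g).hom = Spec.map (CommRingCat.ofHom
      ((MulSemiringAction.toRingEquiv (↥(Subgroup.zpowers σ)) (MvPolynomial (Fin n) k) g⁻¹ :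
        MvPolynomial (Fin n) k ≃+* MvPolynomial (Fin n) k) :
          MvPolynomial (Fin n) k →+* MvPolynomial (Fin n) k)))
    (hJρ : ∀ g : ↥(Subgroup.zpowers σ),
      (affineBlowup.idealSheaf (I12 k n a b c d)).comap (ρ g).hom =
        affineBlowup.idealSheaf (I12 k n a b c d))
    (g : ↥(Subgroup.zpowers σ)) :
    (((affineBlowup.isBlowup (I12 k n a b c d)).liftAction ρ hJρ) g).hom ⁻¹ᵁ chartW₁ k n a b c d =
      chartW₁ k n a b c d := by
  rw [chartW₁_def]
  exact preimage_basicOpen_liftAction_I12 k n σ a b c d hI _ (coe_chartW₁_section k n a b c d)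
    (smul_chartW₁_coeff k n σ a b c d e hab hac had hae hb hc hd hσ) ρ hρ hJρ g

/-! ## The seam at `W₁` -/

include hab hac had hae hb hc hd hσ in
-- the `ActionOver` binder terms are large: head-room for the statement
set_option maxHeartbeats 4000000 in
/-- **THE SEAM at `W₁ = chartW₁`** for the binders `(ρ hρ ρB haut O₁ hO₁)` of `HP₁`
(`stubs/J5Bricks.lean` l.120–131): the `φ`-family, its powers clause, and
`Ω : (k[x][I₁₂t])_{(H′²t·T′²H′t²)} ≃+* Γ(↥O₁.1, (O₁.1.ι ≫ π ≫ q)⁻¹ ⊤)` with (o) the coefficient law,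
(i) `Ω (f/1) = (O₁.1.ι ≫ π)^* f`, (ii) `act g (Ω y) = Ω (φ_{g⁻¹} y)`, (iii)
`Ω y ∈ invariantsRing ⊤ ↔ ∀ g, φ_g y = y`. [OURS · L1 W4.5c] [folklore; assembly of landed decls] -/
theorem exists_sectionsEquiv_chartW₁
    (hI : ∀ g : ↥(Subgroup.zpowers σ), g • I12 k n a b c d = I12 k n a b c d)
    (ρ : ↥(Subgroup.zpowers σ) →* Aut (Spec (CommRingCat.of (MvPolynomial (Fin n) k))))
    (hρ : ∀ g : ↥(Subgroup.zpowers σ), (ρ g).hom = Spec.map (CommRingCat.ofHom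
      ((MulSemiringAction.toRingEquiv (↥(Subgroup.zpowers σ)) (MvPolynomial (Fin n) k) g⁻¹ :
        MvPolynomial (Fin n) k ≃+* MvPolynomial (Fin n) k) :
          MvPolynomial (Fin n) k →+* MvPolynomial (Fin n) k)))
    (hJρ : ∀ g : ↥(Subgroup.zpowers σ),
      (affineBlowup.idealSheaf (I12 k n a b c d)).comap (ρ g).hom =
        affineBlowup.idealSheaf (I12 k n a b c d))
    (ρB : ActionOver (affineBlowup.π (I12 k n a b c d) ≫ qσ) ↥(Subgroup.zpowers σ))
    (haut : ρB.aut = (affineBlowup.isBlowup (I12 k n a b c d)).liftAction ρ hJρ)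
    (O₁ : ρB.StableAffineOpens) (hO₁ : O₁.1 = chartW₁ k n a b c d) :
    ∃ (φ : ↥(Subgroup.zpowers σ) → (reesGrading (I12 k n a b c d) →+*ᵍ reesGrading (I12 k n a b c d)))
      (hP : ∀ g, Submonoid.powers (reesT (JordanFour.hPrime k n a b c ^ 2)
          (hPrime_sq_mem_I12 k n a b c d) * tSqHT2 k n a b c d) ≤
        (Submonoid.powers (reesT (JordanFour.hPrime k n a b c ^ 2)
          (hPrime_sq_mem_I12 k n a b c d) * tSqHT2 k n a b c d)).comap (φ g))
      (Ω : HomogeneousLocalization.Away (reesGrading (I12 k n a b c d))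
          (reesT (JordanFour.hPrime k n a b c ^ 2) (hPrime_sq_mem_I12 k n a b c d) *
            tSqHT2 k n a b c d) ≃+*
        Γ((O₁.1 : Scheme.{0}), (O₁.1.ι ≫ affineBlowup.π (I12 k n a b c d) ≫ qσ) ⁻¹ᵁ ⊤)),
      (∀ (g : ↥(Subgroup.zpowers σ)) x, ((φ g x : reesAlgebra (I12 k n a b c d)) :
          (MvPolynomial (Fin n) k)[X]) =
        (x : (MvPolynomial (Fin n) k)[X]).map ((MulSemiringAction.toRingEquiv
          (↥(Subgroup.zpowers σ)) (MvPolynomial (Fin n) k) g⁻¹ : _ ≃+* _) : _ →+* _)) ∧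
      (∀ f : MvPolynomial (Fin n) k,
        Ω (((fromZeroRingHom (reesGrading (I12 k n a b c d)) (.powers _)).comp
          (reesGrading.zeroRingHom (I12 k n a b c d))) f) =
        (O₁.1.ι ≫ affineBlowup.π (I12 k n a b c d)).appLE ⊤
          ((O₁.1.ι ≫ affineBlowup.π (I12 k n a b c d) ≫ qσ) ⁻¹ᵁ ⊤) le_top (ι₀ f)) ∧
      (∀ (g : ↥(Subgroup.zpowers σ)) y, (ρB.restrict O₁.1 O₁.2.1).act g ⊤ (Ω y) =
        Ω (HomogeneousLocalization.map (φ g⁻¹) (hP g⁻¹) y)) ∧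
      (∀ y, Ω y ∈ (ρB.restrict O₁.1 O₁.2.1).invariantsRing ⊤ ↔
        ∀ g, HomogeneousLocalization.map (φ g) (hP g) y = y) :=
  exists_sectionsEquiv_basicOpen_I12 k n σ a b c d hI _ (chartW₁_section_mem k n a b c d)
    (by norm_num) (coe_chartW₁_section k n a b c d)
    (smul_chartW₁_coeff k n σ a b c d e hab hac had hae hb hc hd hσ) ρ hρ hJρ ρB haut O₁
    (hO₁.trans (chartW₁_def k n a b c d))

end Summit.ResolutionOfSingularities.ResolutionOfSingularities.Theorems.WildQuotientResolution.JordanFive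

end
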